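import Summits.QuantumFields.YangMills.Theorems.BalabanUVNodesN07AtRecord12
import Summits.QuantumFields.YangMills.Theorems.BalabanUVNodesN07SectFChainAtRecord
import Literature.MathematicalPhysics.QuantumFieldTheory.Balaban1983to89.Node00.CarriersZRegSound

/-!
# BalabanUVNodes ∕ N07 ([Balaban1985Variational], `Dag.B11_main`) AT THE STAGE-12 RECORD — SIDES: (A) the bridge laws of p. 280 AT NODE 00's OBJECTS (print's group (4) IS an
# equivalence there: `symm`, `trans` theorems; the bridge displays ONLY its two printed clauses (16)–(18)); (B) the κ₀ = 1 doubly-pinned tower closer so reduced, with its ₁₂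
# ∃-consumer; (C) THE CHAIN CURRENCY of Sect. F AT THE CRIT-PINNED LAYER (seat -c's `ChainLeaves`∕`UnitLeaves` displays, this lineage's `hloc`∕`hcrit` elimination) and its
# ₁₂ ∃-consumer; (D) N07 at node00-def g33's [B8]-KEYED five-pin record `Node00.IsRecordOfRecord₁₂CB10YZWB8` and THE COMPOSABLE FACES AT THE FIVE- AND SIX-PIN STAGE-12 VIEWS
# (what a K1′ `stub_nodes12` knitter applies at the ONE world carrying all thirteen nodes)

Track A of `YM-PLAN.md` (cell `pub-ymgap`, HUMAN RULING D-0062), DAG node **N07** = [Balaban1985Variational] T. Bałaban, *The variational problem and background fields in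
renormalization group method for lattice gauge theories*, Commun. Math. Phys. **102** (1985) 277–309: Thm 1 p. 279 + Props 2–9 pp. 281–309; R141 (C) seat `pub-ymgap-dag-n07-e`
(generation 3; FAN-OUT v1.1 §N07 row s3 continuation); the sequel of this seat's `BalabanUVNodesN07AtRecord12` (p468384; n08-c's `N08AtRecord12Sides` precedent).  CONTENT consumed
BY NAME, nothing restated: `B11Prop7Assembly.Bridge ∕ Bridge.Laws` (r08), `B12GaugeOrbits021.OrbitRel.symm ∕ trans`, seat -c's `N07SectFChainAtRecord.leaves_famXOfRecord_of_chain`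
(p455620) over r08's `B11SectFReg165Assembly` (`ChainLeaves`, `UnitLeaves`, `K165`, `K165_pos`), this lineage's `N07AtRecordCritPinned.b11Leaf_Z11OfRecord_pinCrit_of_prop7_leaves`
(p465289), `N07AtRecordTwoTierOneSided.b11Leaf_Z11OfRecord_of_towerT_parts_kappa_one_noLoc` (p458798), node00-def-B11's `CarriersZSectE` (`prop4∕prop6_Z11OfRecord_withSectE`,
p462651), `N07AtRecord12.exists_record₁₂CB10YZW_b11_main_of_leaf` (p468384), node00-def g32∕g33's `Record12Carriers` (`view₁₂B8B10YZW`, `view₁₂B12B8B10YZW`, `view₁₂B8subB10YZW`,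
`view₁₂B12B8subB10YZW` + their `_leaves`) and `Record12CarriersRecords` (`IsRecordOfRecord₁₂CB10YZWB8`, `…_rebind_of_isRecordOfRecord₁₂C`, `isRecordOfRecord₁₂C_of_…`,
`companion_of_…`, `exists_world_isRecordOfRecord₁₂C`), node00-def-B11 g3's `CarriersZRegSound` (`ResidZ.RegSound`, `reg910T_of_b11Leaf_withSectE_pinCrit_of_regSound`, p467784).  THEOREMS ONLY (0 `def`, 0 `sorry`, 0 `instance`, standard axioms); COUNT-NEUTRAL; `--supports stmt-QuantumFields-19790
--as helper` (K1′ `StabilityBAtRecordR12e`).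

* §A BRIDGE LAWS AT OBJECTS (seat -d's HANDOFF follow-up (i)): at a member `famXOfRecord F N ζ i` of the Props 7–8 ∕ Sect. F family of record «lie on one orbit of the group (4)»
  IS `B12GaugeOrbits021.OrbitRel i.k` — an equivalence relation at NODE 00's objects —, so of the four clauses of r08's `Bridge.Laws` the two structural ones (`symm`, `trans`) are
  THEOREMS (`sameOrbit_famXOfRecord_symm ∕ _trans`) and the dictionary displays ONLY its two printed clauses: `gaugeFix` (p. 280 (18): *«Using the transformations (16) with u
  satisfying (4) we fix the axial gauge conditions … it is enough to consider it on the space (18)»*) and `orbit16` ((16) p. 280 ∕ Prop. 2 p. 281) —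
  **`bridgeLaws_famXOfRecord_of_gaugeFix_orbit16`**.
* §B **`b11Leaf_Z11OfRecord_withSectE_pinCrit_of_towerT_parts_kappa_one_of_gaugeFix_orbit16`**: this lineage's ★ κ₀ = 1 doubly-pinned tower closer (p465289 §3) with the bridge
  hypothesis `laws` REPLACED by the two printed clauses in OBJECT FORM («critical» = `Node00.IsCritOfRecord`, «one orbit» = `OrbitRel`); its ₁₂ ∃-consumer
  `exists_record₁₂CB10YZW_b11_main_withSectE_pinCrit_of_towerT_parts_kappa_one_of_gaugeFix_orbit16`.
* §C THE CHAIN CURRENCY AT THE CRIT-PINNED LAYER: **`b11Leaf_Z11OfRecord_pinCrit_of_prop7_chain`** — the [B11] leaf at `Z11OfRecord F N ζ.pinCrit` from Props 2–7, 9 + seat -c's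
  CHAIN DISPLAYS of the printed proof of (152) ∧ (165) (`ChainLeaves`: (152)–(153), (157), (158), (46)∕(117), (55), (98), (161)₁, (160), (155), (144)∕(148), (162)–(163) at per-cube
  data; `UnitLeaves`: their Δ₀(□) twins) + the three remaining located leaves ([6] (1.141)–(1.142) at the background 1, locality of (2), [6] Thm 2 (1.36)) — NO `hcrit` (the slot is
  print's «critical», g2), NO `hloc` (F-n07e-1, g0); and **`exists_record₁₂CB10YZW_b11_main_pinCrit_of_prop7_chain`** — seat -c's HANDOFF trigger (t0) («the consumer one storey
  up») answered in the ₁₂ currency: REAL Stage-12 runs modulo K0′, not the ex-falso ₁₁ storey.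
* §D N07 AT THE [B8]-KEYED FIVE-PIN STAGE-12 RECORD AND AT THE RICHER VIEWS: `b11_main_at_view₁₂B8B10YZW_of_leaf`, `b11_main_at_view₁₂B12B8B10YZW_of_leaf`,
  `b11_main_at_view₁₂B8subB10YZW_of_leaf`, `b11_main_at_view₁₂B12B8subB10YZW_of_leaf` (THE COMPOSABLE FACES: any world bound to the five-∕six-pin view presenting `ζ`, leaf at
  `ζ` ⇒ `Dag.B11_main` every run — the form a K1′ knitter uses at the common world where [B8] ∕ [B12] are pinned too), `b11_main_of_isRecordOfRecord₁₂CB10YZWB8_of_slot` (g33's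
  `_of_slots` idiom at the [B8] key, N07 alone), `exists_record₁₂CB10YZWB8_b11_main_of_leaf` (the ∃-direction at the five-pin key), `exists_isRecordOfRecord₁₂C_b11_main_of_leaf_pinB8`
  (K1′'s ∃-form served at the FIVE-pin key for the N07 conjunct GIVEN ₁₂C-inhabitation at `F`, HYPOTHESIS).
* §E THE NODE SENTENCE IN PRINT's (9)–(10) CURRENCY (node00-def-B11 g3's by-name ask, l.13859): **`reg910T_withSectE_pinCrit_of_towerT_parts_kappa_one_of_regSound`** — §B's displayed
  inputs + the SOUNDNESS LAW `hs : ζ.RegSound g` of the residual regularity data ⇒ Theorem 1's regularity (9)–(10) in print's ∃u-form `B11Reg910Classes.Reg910T` at every member, every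
  `V` with (7), every minimiser of (5) on 𝔘_k(B₃ε₁) ∩ 𝔅_k(V), every cube of size ≤ M(ε₁) (`reg910T_of_b11Leaf_withSectE_pinCrit_of_regSound` BY NAME; F8 stays HALVED — the law is
  displayed, the gauge-fixed pin of `ζ.R` unowned).
OWED NOTES FOLDED IN (dag-ref-G READ30 N1∕N2 on p465289, dag-ref-C READ121 NOTE 1): (N1) «nothing else» in §B∕§E is UP TO the Sect.-E datum's own Prop-4 slot `SectEDatum.prop4` (Prop 4
BY HYPOTHESIS inside `E`, n07-b's design) and the N05∕N06 in-edge letters `norm_G`, `norm_H₁`, `sat14_B` riding on `E`; (N2) at the level-0 members `⟨K, 0, _⟩` the pinned «critical»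
`Node00.IsCritOfRecord F N K 0` is trivially true (𝔅₀(V) = {V}: every admissible curve is constant) — harmless, the Props 7∕8∕Sect-F statements there concern `V` itself; and
`IsCritOfRecord` is junk-TRUE off 𝔅_k(V) (no admissible curve) — harmless since every consumer carries `InB V U`.
HONEST FRAMING.  Kernel bookkeeping BY NAME; NO estimate of [Balaban1985Variational] proved here; the printed statements (Props 2, 3, 5, 8, 9, Sect. F or its chain displays, the
two printed bridge clauses, the capped existence leaves of pp. 296–299, (14) at the bridge, the constant relations) stay DISPLAYED; N07 NOT discharged (5∕27 untouched); the
∀-form over the pinned keys stays junk-refutable through `ζ.R` (`N07AtRecord12.not_s_N07_record₁₂CB10YZW_of_params`).  One finite four-torus programme at fixed `ε` per run — NOT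
ℝ⁴, NOT infinite volume, NOT OS, NOT a mass gap, NOT Clay.  Restate-immune (no `def`).
-/

noncomputable section

namespace Summit.QuantumFields.YangMills.BalabanUVNodes.N07AtRecord12Sides

open Literature.MathematicalPhysics.QuantumFieldTheory.Balaban1983to89
open Literature.MathematicalPhysics.QuantumFieldTheory.Balaban1983to89.T4Continuum (T4Family FiniteEpsData)
open Literature.MathematicalPhysics.QuantumFieldTheory.Balaban1983to89.DagBinding
open Literature.MathematicalPhysics.QuantumFieldTheory.Balaban1983to89.Node00
open Literature.MathematicalPhysics.QuantumFieldTheory.Balaban1983to89.B12GaugeOrbits021 (OrbitRel)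
open Literature.MathematicalPhysics.QuantumFieldTheory.Balaban1983to89.B11Prop7Assembly (Bridge ExistenceLeavesCap)
open Literature.MathematicalPhysics.QuantumFieldTheory.Balaban1983to89.B11SectFAssembly (CubeData Leaves tinv)
open Literature.MathematicalPhysics.QuantumFieldTheory.Balaban1983to89.B11SectFReg165Assembly (ChainData UnitData ChainLeaves UnitLeaves K165 K165_pos)
open Literature.MathematicalPhysics.QuantumFieldTheory.Balaban1983to89.B11Holder9 (HolderClause)
open YMDAG.UVSplit (RecordPred Datum AtRecord S_N07)
open Summit.QuantumFields.YangMills.BalabanUVNodes.N06AtRecord9CB10Y (exists_junkOps_b9LeafX_Y9OfRecord)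
open Summit.QuantumFields.YangMills.BalabanUVNodes.N07SectFChainAtRecord (leaves_famXOfRecord_of_chain)
open Summit.QuantumFields.YangMills.BalabanUVNodes.N07AtRecordTwoTierOneSided (b11Leaf_Z11OfRecord_of_towerT_parts_kappa_one_noLoc)
open Summit.QuantumFields.YangMills.BalabanUVNodes.N07AtRecordCritPinned (b11Leaf_Z11OfRecord_pinCrit_of_prop7_leaves)
open Summit.QuantumFields.YangMills.BalabanUVNodes.N07AtRecord12 (exists_record₁₂CB10YZW_b11_main_of_leaf)
open Literature.MathematicalPhysics.QuantumFieldTheory.Balaban1983to89.B11Reg910Classes (Reg910T)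
open scoped Matrix.Norms.L2Operator

variable {N : ℕ} [NeZero N] {F : T4Family} {D : FiniteEpsData F (Node00.SU N)} {w : WorldP}

/-! ## §A The bridge laws at NODE 00's objects: print's group (4) is an equivalence; the dictionary displays only its printed clauses -/

/-- At a member of the Props 7–8 ∕ Sect. F family of record «lie on one orbit of the group (4)» (`B12GaugeOrbits021.OrbitRel i.k`, an OBJECT) is SYMMETRIC.
[cite: Balaban1985Variational, (4) p.278 (the residual gauge group; bookkeeping: a group's orbit relation)] -/
theorem sameOrbit_famXOfRecord_symm (ζ : ResidZ F N) (i : ZIdx) (U U' : GaugeField (F.P i.K) 0 (SU N))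
    (h : (famXOfRecord F N ζ i).SameOrbit U U') : (famXOfRecord F N ζ i).SameOrbit U' U :=
  OrbitRel.symm h

/-- … and TRANSITIVE. [cite: Balaban1985Variational, (4) p.278 (bookkeeping: a group's orbit relation)] -/
theorem sameOrbit_famXOfRecord_trans (ζ : ResidZ F N) (i : ZIdx) (U U' U'' : GaugeField (F.P i.K) 0 (SU N))
    (h : (famXOfRecord F N ζ i).SameOrbit U U') (h' : (famXOfRecord F N ζ i).SameOrbit U' U'') : (famXOfRecord F N ζ i).SameOrbit U U'' :=
  OrbitRel.trans h h'

/-- ★ **r08's BRIDGE LAWS AT NODE 00's OBJECTS FROM THEIR TWO PRINTED CLAUSES** (seat -d's follow-up (i)): for a bridge `β` between the member `famXOfRecord F N ζ i` and a Sect. A–E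
carrier `D`, `β.Laws C₁ B₃` ⇐ `gaugeFix` (p. 280: every `U` in (6) = 𝔘_k(ε₀) ∩ 𝔅_k(V) — here `InUkClassB11 … ε₀ U`, `Q̄ᵏU = V` — lies on the orbit (`OrbitRel i.k`) of some `U′U₀` with
`U′` in (18), and `U` critical (`ζ.IsCrit i`) ⇒ `U′U₀` critical on the Sect. A–E side) and `orbit16` ((16): the two axial-gauge images of ONE `U₁U₀` lie on one orbit) — `symm` and
`trans` are the theorems above. [cite: Balaban1985Variational, (4) p.278, (15)–(18) p.280, Prop. 2 p.281] -/
theorem bridgeLaws_famXOfRecord_of_gaugeFix_orbit16 (ζ : ResidZ F N) (i : ZIdx) {Dlg : B11.LGData} (β : Bridge (famXOfRecord F N ζ i) Dlg) (C₁ B₃ : ℝ)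
    (gaugeFix : ∀ (ε₀ ε₁ : ℝ) (V : GaugeField (F.P i.K) i.k (SU N)) (U₀ : Dlg.Cfg) (U : GaugeField (F.P i.K) 0 (SU N)),
      Dlg.Sat14 (C₁ * B₃ * ε₁) (C₁ * ε₁) (β.bdry V) U₀ → InUkClassB11 F N i.K i.k ε₀ U → Averaging.iter (avOfRecord F N i.K) i.k U = V →
        ∃ U' : Dlg.Pert, Dlg.In18 ε₀ (β.bdry V) U₀ U' ∧ OrbitRel i.k U (β.emb U₀ U') ∧ (ζ.IsCrit i V U → Dlg.Crit (β.bdry V) U₀ U'))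
    (orbit16 : ∀ (U₀ : Dlg.Cfg) (U₁ : Dlg.Pert) (u u' : Dlg.GT), Dlg.Restricted U₀ u → Dlg.Restricted U₀ u' →
      OrbitRel i.k (β.emb U₀ (Dlg.toAxial U₀ U₁ u)) (β.emb U₀ (Dlg.toAxial U₀ U₁ u'))) :
    β.Laws C₁ B₃ :=
  ⟨gaugeFix, orbit16, fun _ _ h => OrbitRel.symm h, fun _ _ _ h h' => OrbitRel.trans h h'⟩

/-! ## §B The κ₀ = 1 doubly-pinned tower closer with the bridge reduced to its printed clauses, and its ₁₂ ∃-consumer -/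

section TowerReduced

variable {L : ℝ} {η : ZIdx → ℝ} [Fact (0 < L)] [∀ i, Fact (0 < η i)] {β : ZIdx → Type} [∀ i, Fintype (β i)]

/-- ★ **THE PRINTED TOWER (κ₀ = 1) AT THE DOUBLY-PINNED LAYER, BRIDGE DISPLAYED BY ITS PRINTED CLAUSES ONLY**: the [B11] leaf at `Z11OfRecord F N (ζ.withSectE E).pinCrit` from Props 2, 3,
5 (Sect.-E family), Prop 8 + Sect. F (Props 7–8 family at the ONE constant `ζ.B₃`), Prop. 9, the bridge DATA `βr`, `bg` with (14) at the bridge (`hbg14`), the TWO printed bridge clauses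
`gaugeFix` ((18) p. 280; «critical» = `Node00.IsCritOfRecord`, «one orbit» = `OrbitRel`) and `orbit16` ((16)), the capped existence leaves of pp. 296–299 ∕ 301, and the constant
relations — Theorem 1 AND Proposition 7 DERIVED by the repaired Sect.-A induction (this lineage's `…_kappa_one_noLoc`, p458798), p4∕p6 by node00-def-B11's Sect.-E theorems, `hcrit` by
`Node00.hcrit_pinCrit`, `symm`∕`trans` by §A.  NOT a discharge: every printed statement displayed. [cite: Balaban1985Variational, Thm 1 p.279, Sect. A (11)–(18) pp.279–280, Props 2–9 pp.281–309] -/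
theorem b11Leaf_Z11OfRecord_withSectE_pinCrit_of_towerT_parts_kappa_one_of_gaugeFix_orbit16 (ζ : ResidZ F N) (E : SectEPres F N L η β ζ)
    (hC₄ : 0 < E.C₄) (ha₃ : 0 < E.a₃) (hα : 0 < E.α)
    (βr : ∀ i : ZIdx, Bridge (famXOfRecord F N (ζ.withSectE E).pinCrit i) ((ζ.withSectE E).famLG i))
    (bg : ∀ i : ZIdx, GaugeField (F.P i.K) 0 (SU N) → ((ζ.withSectE E).famLG i).Cfg) {O₁ O₂ e₅ : ℝ}
    (hbg14 : ∀ (i : ZIdx) (ε : ℝ) (V : GaugeField (F.P i.K) i.k (SU N)) (U : GaugeField (F.P i.K) 0 (SU N)),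
      InUkClassB11 F N i.K i.k (ζ.C₁ * ζ.B₃ * ε) U → Averaging.iter (avOfRecord F N i.K) i.k U = V →
        ((ζ.withSectE E).famLG i).Sat14 (ζ.C₁ * ζ.B₃ * ε) (ζ.C₁ * ε) ((βr i).bdry V) (bg i U))
    (gaugeFix : ∀ (i : ZIdx) (ε₀ ε₁ : ℝ) (V : GaugeField (F.P i.K) i.k (SU N)) (U₀ : ((ζ.withSectE E).famLG i).Cfg) (U : GaugeField (F.P i.K) 0 (SU N)),
      ((ζ.withSectE E).famLG i).Sat14 (ζ.C₁ * ζ.B₃ * ε₁) (ζ.C₁ * ε₁) ((βr i).bdry V) U₀ → InUkClassB11 F N i.K i.k ε₀ U →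
        Averaging.iter (avOfRecord F N i.K) i.k U = V →
          ∃ U' : ((ζ.withSectE E).famLG i).Pert, ((ζ.withSectE E).famLG i).In18 ε₀ ((βr i).bdry V) U₀ U' ∧ OrbitRel i.k U ((βr i).emb U₀ U') ∧
            (IsCritOfRecord F N i.K i.k V U → ((ζ.withSectE E).famLG i).Crit ((βr i).bdry V) U₀ U'))
    (orbit16 : ∀ (i : ZIdx) (U₀ : ((ζ.withSectE E).famLG i).Cfg) (U₁ : ((ζ.withSectE E).famLG i).Pert) (u u' : ((ζ.withSectE E).famLG i).GT),
      ((ζ.withSectE E).famLG i).Restricted U₀ u → ((ζ.withSectE E).famLG i).Restricted U₀ u' →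
        OrbitRel i.k ((βr i).emb U₀ (((ζ.withSectE E).famLG i).toAxial U₀ U₁ u)) ((βr i).emb U₀ (((ζ.withSectE E).famLG i).toAxial U₀ U₁ u')))
    (leaves : ∀ i, ExistenceLeavesCap (βr i) ζ.B₀ ζ.B₃ ζ.C₁ O₁ O₂ e₅)
    (hB₀ : 0 < ζ.B₀) (hB₁ : 0 < ζ.B₁) (hB₃ : 1 ≤ ζ.B₃) (hC₁L : (F.L : ℝ) ^ 3 ≤ ζ.C₁) (hB₀B₁ : ζ.B₀ ≤ 4 * ζ.B₁)
    (hc₁ : 0 < ζ.c₁) (hO₁ : 0 < O₁) (hO₂ : 0 < O₂) (he₅ : 0 < e₅)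
    (p2 : B11.Prop2Printed ζ.B₁ ζ.B₃ ζ.C₁ ζ.c₁ (ζ.withSectE E).famLG) (p3 : B11.Prop3Printed ζ.C₁ ζ.B₃ ζ.C₂ ζ.C₃ ζ.B₀ ζ.c1h ζ.c₄ ζ.δ₀ (ζ.withSectE E).famLG)
    (p5 : B11.Prop5Printed ζ.B₁ ζ.B₃ ζ.C₁ (ζ.withSectE E).famLG)
    (p8 : B11.Prop8Printed ζ.B₃ (famXOfRecord F N (ζ.withSectE E).pinCrit)) (sF : B11.SectFPrinted ζ.B₃ (famXOfRecord F N (ζ.withSectE E).pinCrit))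
    (p9 : B11.Prop9Printed ζ.B₅ ζ.C₁ ζ.β₀ ζ.δ₀ ζ.famAn) :
    B11Leaf (Z11OfRecord F N (ζ.withSectE E).pinCrit) := by
  have hB₃' : 0 < ζ.B₃ := lt_of_lt_of_le one_pos hB₃
  have hC₁ : 0 < ζ.C₁ := by
    have hL1 : (1 : ℝ) ≤ (F.L : ℝ) := by exact_mod_cast (F.P 0).L_pos
    exact lt_of_lt_of_le one_pos (le_trans (one_le_pow₀ (M₀ := ℝ) (n := 3) hL1) hC₁L)
  have laws : ∀ i, (βr i).Laws ζ.C₁ ζ.B₃ := fun i =>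
    bridgeLaws_famXOfRecord_of_gaugeFix_orbit16 (ζ.withSectE E).pinCrit i (βr i) ζ.C₁ ζ.B₃ (gaugeFix i) (orbit16 i)
  exact b11Leaf_Z11OfRecord_of_towerT_parts_kappa_one_noLoc (ζ.withSectE E).pinCrit βr bg hbg14 laws leaves (hcrit_pinCrit _) hB₀ hB₁ hB₃ hC₁L hB₀B₁
    hc₁ hO₁ hO₂ he₅ p2 p3 (prop4_Z11OfRecord_withSectE ζ E hC₄ ha₃ hB₃' hα hC₁) p5 (prop6_Z11OfRecord_withSectE ζ E hB₀ hC₄ ha₃ hB₃' hα hC₁) p8 sF p9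

/-- **… AND ITS STAGE-12 CONSUMER**: the same displayed inputs ⇒ N07 HOLDS at every run of a ₁₂CB10YZW record over `datumOfRecord₁₂ θ h` presented with `(ζ.withSectE E).pinCrit` (REAL
Stage-12 runs modulo K0′; ∃-currency at a NAMED layer; NOT a discharge). [cite: Balaban1985Variational, Thm 1 p.279, Sect. A (11)–(18) pp.279–280, Props 2–9 pp.281–309] -/
theorem exists_record₁₂CB10YZW_b11_main_withSectE_pinCrit_of_towerT_parts_kappa_one_of_gaugeFix_orbit16 (θ : Stage12Params F N)
    (h : θ.Provisos₁₂ F N) (hθ : θ.Admissible F N) (hγ : 0 < θ.γ) (Mstar : ℕ) (ops : OpsY N θ.toStage3Params Mstar) (lamW : ResidW F N)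
    (ζ : ResidZ F N) (E : SectEPres F N L η β ζ) (hC₄ : 0 < E.C₄) (ha₃ : 0 < E.a₃) (hα : 0 < E.α)
    (βr : ∀ i : ZIdx, Bridge (famXOfRecord F N (ζ.withSectE E).pinCrit i) ((ζ.withSectE E).famLG i))
    (bg : ∀ i : ZIdx, GaugeField (F.P i.K) 0 (SU N) → ((ζ.withSectE E).famLG i).Cfg) {O₁ O₂ e₅ : ℝ}
    (hbg14 : ∀ (i : ZIdx) (ε : ℝ) (V : GaugeField (F.P i.K) i.k (SU N)) (U : GaugeField (F.P i.K) 0 (SU N)),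
      InUkClassB11 F N i.K i.k (ζ.C₁ * ζ.B₃ * ε) U → Averaging.iter (avOfRecord F N i.K) i.k U = V →
        ((ζ.withSectE E).famLG i).Sat14 (ζ.C₁ * ζ.B₃ * ε) (ζ.C₁ * ε) ((βr i).bdry V) (bg i U))
    (gaugeFix : ∀ (i : ZIdx) (ε₀ ε₁ : ℝ) (V : GaugeField (F.P i.K) i.k (SU N)) (U₀ : ((ζ.withSectE E).famLG i).Cfg) (U : GaugeField (F.P i.K) 0 (SU N)),
      ((ζ.withSectE E).famLG i).Sat14 (ζ.C₁ * ζ.B₃ * ε₁) (ζ.C₁ * ε₁) ((βr i).bdry V) U₀ → InUkClassB11 F N i.K i.k ε₀ U →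
        Averaging.iter (avOfRecord F N i.K) i.k U = V →
          ∃ U' : ((ζ.withSectE E).famLG i).Pert, ((ζ.withSectE E).famLG i).In18 ε₀ ((βr i).bdry V) U₀ U' ∧ OrbitRel i.k U ((βr i).emb U₀ U') ∧
            (IsCritOfRecord F N i.K i.k V U → ((ζ.withSectE E).famLG i).Crit ((βr i).bdry V) U₀ U'))
    (orbit16 : ∀ (i : ZIdx) (U₀ : ((ζ.withSectE E).famLG i).Cfg) (U₁ : ((ζ.withSectE E).famLG i).Pert) (u u' : ((ζ.withSectE E).famLG i).GT),
      ((ζ.withSectE E).famLG i).Restricted U₀ u → ((ζ.withSectE E).famLG i).Restricted U₀ u' →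
        OrbitRel i.k ((βr i).emb U₀ (((ζ.withSectE E).famLG i).toAxial U₀ U₁ u)) ((βr i).emb U₀ (((ζ.withSectE E).famLG i).toAxial U₀ U₁ u')))
    (leaves : ∀ i, ExistenceLeavesCap (βr i) ζ.B₀ ζ.B₃ ζ.C₁ O₁ O₂ e₅)
    (hB₀ : 0 < ζ.B₀) (hB₁ : 0 < ζ.B₁) (hB₃ : 1 ≤ ζ.B₃) (hC₁L : (F.L : ℝ) ^ 3 ≤ ζ.C₁) (hB₀B₁ : ζ.B₀ ≤ 4 * ζ.B₁)
    (hc₁ : 0 < ζ.c₁) (hO₁ : 0 < O₁) (hO₂ : 0 < O₂) (he₅ : 0 < e₅)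
    (p2 : B11.Prop2Printed ζ.B₁ ζ.B₃ ζ.C₁ ζ.c₁ (ζ.withSectE E).famLG) (p3 : B11.Prop3Printed ζ.C₁ ζ.B₃ ζ.C₂ ζ.C₃ ζ.B₀ ζ.c1h ζ.c₄ ζ.δ₀ (ζ.withSectE E).famLG)
    (p5 : B11.Prop5Printed ζ.B₁ ζ.B₃ ζ.C₁ (ζ.withSectE E).famLG)
    (p8 : B11.Prop8Printed ζ.B₃ (famXOfRecord F N (ζ.withSectE E).pinCrit)) (sF : B11.SectFPrinted ζ.B₃ (famXOfRecord F N (ζ.withSectE E).pinCrit))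
    (p9 : B11.Prop9Printed ζ.B₅ ζ.C₁ ζ.β₀ ζ.δ₀ ζ.famAn) :
    ∃ w : WorldP, IsRecordOfRecord₁₂CB10YZW F N (datumOfRecord₁₂ F N θ h) w ∧ ∀ P : B12.RunParams, Dag.B11_main (leavesP w P) :=
  exists_record₁₂CB10YZW_b11_main_of_leaf θ h hθ hγ Mstar ops _ lamW
    (b11Leaf_Z11OfRecord_withSectE_pinCrit_of_towerT_parts_kappa_one_of_gaugeFix_orbit16 ζ E hC₄ ha₃ hα βr bg hbg14 gaugeFix orbit16 leaves
      hB₀ hB₁ hB₃ hC₁L hB₀B₁ hc₁ hO₁ hO₂ he₅ p2 p3 p5 p8 sF p9)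

end TowerReduced

/-! ## §C The chain currency of Sect. F at the crit-pinned layer (seat -c's displays), and its Stage-12 consumer -/

section Chain

variable (ζ : ResidZ F N) (Dc : ∀ i : ZIdx, CubeData (famXOfRecord F N ζ.pinCrit i))
  {E Fc : (i : ZIdx) → (famXOfRecord F N ζ.pinCrit i).Cube → Type} [∀ i c, SeminormedAddCommGroup (E i c)] [∀ i c, SeminormedAddCommGroup (Fc i c)]
  {g : ZIdx → B6.Geometry} {d : ℕ} {X : ∀ i : ZIdx, ChainData (famXOfRecord F N ζ.pinCrit i) (E i) (Fc i) (g i) d}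
  {Y : ∀ i : ZIdx, UnitData (famXOfRecord F N ζ.pinCrit i) (E i) (g i)} {δ₀ B₀ B₂ C₂ C₄ S R₁M₁ a₃ a₄ L : ℝ}

/-- ★ **THE [B11] LEAF AT THE CRIT-PINNED BUNDLE OF RECORD FROM PROPS 2–7, 9 AND THE CHAIN DISPLAYS OF SECT. F — NO `hcrit`, NO `hloc`**: seat -c's `leaves_famXOfRecord_of_chain`
(per member: `ChainLeaves` ∕ `UnitLeaves` at per-cube data, `(g i).L = L`, [6] (1.141)–(1.142) at the background 1 (`dev1142`), locality and gauge invariance of (2) (`inU_local`), [6]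
Thm 2 (1.36) (`holder136`, whose «critical» IS `Node00.IsCritOfRecord` at this layer — `N07AtRecordCritPinned.famXOfRecord_pinCrit_isCritical_iff`), K := `K165 d L B₀ B₁ C₂ C₄ R₁M₁`)
feeding this lineage's `b11Leaf_Z11OfRecord_pinCrit_of_prop7_leaves` (Prop 8 by the halving iteration with the repaired (166′), (169) with `B₄ = 9dL²B₂B₃`, then
`B11.thm1_of_prop7_prop8_sectF`; «minimal ⇒ critical» a theorem at the pin, the restriction law eliminated).  The finest located currency of N07's Sect. F in the tree, two storeys below
`SectFPrinted`. [cite: Balaban1985Variational, Thm 1 p.279, Props 2–9 pp.281–309, Prop. 8 p.304, Sect. F (144)–(169) pp.300–305] -/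
theorem b11Leaf_Z11OfRecord_pinCrit_of_prop7_chain (hgL : ∀ i, (g i).L = L)
    (hX : ∀ i, ChainLeaves (famXOfRecord F N ζ.pinCrit i) (X i) δ₀ B₀ ζ.B₁ ζ.B₃ C₂ C₄ S R₁M₁ ζ.c₁ a₃ a₄)
    (hY : ∀ i, UnitLeaves (famXOfRecord F N ζ.pinCrit i) (X i) (Dc i) (Y i) δ₀ B₀ ζ.c₁)
    (dev1142 : ∀ (i : ZIdx) (U : (famXOfRecord F N ζ.pinCrit i).Cfg) (c : (famXOfRecord F N ζ.pinCrit i).Cube) (e : ℝ),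
      (famXOfRecord F N ζ.pinCrit i).Gauged U c → 0 < e → e ≤ 1 →
      (Dc i).normA0 U c < e * tinv (famXOfRecord F N ζ.pinCrit i) c ^ 1 → (Dc i).normGradA0 U c < e * tinv (famXOfRecord F N ζ.pinCrit i) c ^ 2 →
      (Dc i).normLapA0 U c < e * tinv (famXOfRecord F N ζ.pinCrit i) c ^ 3 →
      (Dc i).plaqDev U c < 2 * e + 8 * e ^ 2 ∧ (Dc i).dstarDev U c < e + 36 * (d : ℝ) * e ^ 2 + 50 * (d : ℝ) * e ^ 3)
    (inU_local : ∀ (i : ZIdx) (r : ℝ) (U : (famXOfRecord F N ζ.pinCrit i).Cfg), 0 < r →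
      (∀ c : (famXOfRecord F N ζ.pinCrit i).Cube, (famXOfRecord F N ζ.pinCrit i).sizeM c = R₁M₁ → (Dc i).plaqDev U c < r ∧ (Dc i).dstarDev U c < r) →
      (famXOfRecord F N ζ.pinCrit i).InU r U)
    (holder136 : ∀ (i : ZIdx) (ε₀ ε₁ : ℝ) (V : (famXOfRecord F N ζ.pinCrit i).Bdry) (U : (famXOfRecord F N ζ.pinCrit i).Cfg)
      (c : (famXOfRecord F N ζ.pinCrit i).Cube),
      0 < ε₁ → (famXOfRecord F N ζ.pinCrit i).Reg7 ε₁ V → (famXOfRecord F N ζ.pinCrit i).InU ε₀ U → (famXOfRecord F N ζ.pinCrit i).InB V U →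
      (famXOfRecord F N ζ.pinCrit i).IsCritical V U → 9 * (d : ℝ) * L ^ 2 * (famXOfRecord F N ζ.pinCrit i).sizeM c * ε₀ ≤ ζ.c₁ →
      HolderClause ((famXOfRecord F N ζ.pinCrit i).holderA U c) 1 (B₂ * (ε₀ + (9 * (d : ℝ) * L ^ 2 * (famXOfRecord F N ζ.pinCrit i).sizeM c * ε₀ - ε₀)))
        (tinv (famXOfRecord F N ζ.pinCrit i) c))
    (hd : 1 ≤ d) (hL : 0 < L) (hB₀ : 0 < B₀) (hB₂ : 0 < B₂) (hC : 0 < C₄ + 4 * C₂) (hR : 1 ≤ R₁M₁) (ha₃ : 0 < a₃) (ha₄ : 0 < a₄)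
    (hB₁ : 0 < ζ.B₁) (hB₃ : 0 < ζ.B₃) (hC₁ : 0 < ζ.C₁) (hc₁ : 0 < ζ.c₁)
    (p2 : B11.Prop2Printed ζ.B₁ ζ.B₃ ζ.C₁ ζ.c₁ ζ.famLG) (p3 : B11.Prop3Printed ζ.C₁ ζ.B₃ ζ.C₂ ζ.C₃ ζ.B₀ ζ.c1h ζ.c₄ ζ.δ₀ ζ.famLG)
    (p4 : B11.Prop4Printed ζ.C₁ ζ.B₃ ζ.famLG) (p5 : B11.Prop5Printed ζ.B₁ ζ.B₃ ζ.C₁ ζ.famLG) (p6 : B11.Prop6Printed ζ.B₀ ζ.B₃ ζ.C₁ ζ.famLG)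
    (p7 : B11.Prop7Printed ζ.B₃ ζ.C₁ (famXOfRecord F N ζ.pinCrit)) (p9 : B11.Prop9Printed ζ.B₅ ζ.C₁ ζ.β₀ ζ.δ₀ ζ.famAn) :
    B11Leaf (Z11OfRecord F N ζ.pinCrit) :=
  have hd' : (1 : ℝ) ≤ d := by exact_mod_cast hd
  have hK : 0 < K165 d L B₀ ζ.B₁ C₂ C₄ R₁M₁ := K165_pos hd hL hB₀ hB₁ hC (by linarith)
  b11Leaf_Z11OfRecord_pinCrit_of_prop7_leaves ζ Dc
    (fun i => leaves_famXOfRecord_of_chain ζ.pinCrit i (Dc i) (hgL i) (hX i) (hY i) (dev1142 i) (inU_local i) (holder136 i))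
    hd' hL hB₂ hK hR ha₃ ha₄ hB₁ hB₃ hC₁ hc₁ p2 p3 p4 p5 p6 p7 p9

/-- **SEAT -c's TRIGGER (t0) IN THE ₁₂ CURRENCY**: Props 2–7, 9 + the chain displays of Sect. F + the three remaining located leaves at `ζ.pinCrit` ⇒ N07 HOLDS at every run of a
₁₂CB10YZW record over `datumOfRecord₁₂ θ h` presented with the layer `ζ.pinCrit` — every admissible Stage-12 `θ` with its provisos and `γ > 0` (REAL runs modulo K0′; the ₁₀ ∕ ₁₁ storeys
of seat -c's `exists_record₁₀CB10YZ_b11_main_of_prop7_chain` sit below the repaired record resp. ex falso).  NOT a discharge. [cite: Balaban1985Variational, Thm 1 p.279, Props 2–9 pp.281–309, Sect. F pp.300–305] -/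
theorem exists_record₁₂CB10YZW_b11_main_pinCrit_of_prop7_chain (θ : Stage12Params F N) (h : θ.Provisos₁₂ F N) (hθ : θ.Admissible F N) (hγ : 0 < θ.γ)
    (Mstar : ℕ) (ops : OpsY N θ.toStage3Params Mstar) (lamW : ResidW F N) (hgL : ∀ i, (g i).L = L)
    (hX : ∀ i, ChainLeaves (famXOfRecord F N ζ.pinCrit i) (X i) δ₀ B₀ ζ.B₁ ζ.B₃ C₂ C₄ S R₁M₁ ζ.c₁ a₃ a₄)
    (hY : ∀ i, UnitLeaves (famXOfRecord F N ζ.pinCrit i) (X i) (Dc i) (Y i) δ₀ B₀ ζ.c₁)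
    (dev1142 : ∀ (i : ZIdx) (U : (famXOfRecord F N ζ.pinCrit i).Cfg) (c : (famXOfRecord F N ζ.pinCrit i).Cube) (e : ℝ),
      (famXOfRecord F N ζ.pinCrit i).Gauged U c → 0 < e → e ≤ 1 →
      (Dc i).normA0 U c < e * tinv (famXOfRecord F N ζ.pinCrit i) c ^ 1 → (Dc i).normGradA0 U c < e * tinv (famXOfRecord F N ζ.pinCrit i) c ^ 2 →
      (Dc i).normLapA0 U c < e * tinv (famXOfRecord F N ζ.pinCrit i) c ^ 3 →
      (Dc i).plaqDev U c < 2 * e + 8 * e ^ 2 ∧ (Dc i).dstarDev U c < e + 36 * (d : ℝ) * e ^ 2 + 50 * (d : ℝ) * e ^ 3)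
    (inU_local : ∀ (i : ZIdx) (r : ℝ) (U : (famXOfRecord F N ζ.pinCrit i).Cfg), 0 < r →
      (∀ c : (famXOfRecord F N ζ.pinCrit i).Cube, (famXOfRecord F N ζ.pinCrit i).sizeM c = R₁M₁ → (Dc i).plaqDev U c < r ∧ (Dc i).dstarDev U c < r) →
      (famXOfRecord F N ζ.pinCrit i).InU r U)
    (holder136 : ∀ (i : ZIdx) (ε₀ ε₁ : ℝ) (V : (famXOfRecord F N ζ.pinCrit i).Bdry) (U : (famXOfRecord F N ζ.pinCrit i).Cfg)
      (c : (famXOfRecord F N ζ.pinCrit i).Cube),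
      0 < ε₁ → (famXOfRecord F N ζ.pinCrit i).Reg7 ε₁ V → (famXOfRecord F N ζ.pinCrit i).InU ε₀ U → (famXOfRecord F N ζ.pinCrit i).InB V U →
      (famXOfRecord F N ζ.pinCrit i).IsCritical V U → 9 * (d : ℝ) * L ^ 2 * (famXOfRecord F N ζ.pinCrit i).sizeM c * ε₀ ≤ ζ.c₁ →
      HolderClause ((famXOfRecord F N ζ.pinCrit i).holderA U c) 1 (B₂ * (ε₀ + (9 * (d : ℝ) * L ^ 2 * (famXOfRecord F N ζ.pinCrit i).sizeM c * ε₀ - ε₀)))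
        (tinv (famXOfRecord F N ζ.pinCrit i) c))
    (hd : 1 ≤ d) (hL : 0 < L) (hB₀ : 0 < B₀) (hB₂ : 0 < B₂) (hC : 0 < C₄ + 4 * C₂) (hR : 1 ≤ R₁M₁) (ha₃ : 0 < a₃) (ha₄ : 0 < a₄)
    (hB₁ : 0 < ζ.B₁) (hB₃ : 0 < ζ.B₃) (hC₁ : 0 < ζ.C₁) (hc₁ : 0 < ζ.c₁)
    (p2 : B11.Prop2Printed ζ.B₁ ζ.B₃ ζ.C₁ ζ.c₁ ζ.famLG) (p3 : B11.Prop3Printed ζ.C₁ ζ.B₃ ζ.C₂ ζ.C₃ ζ.B₀ ζ.c1h ζ.c₄ ζ.δ₀ ζ.famLG)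
    (p4 : B11.Prop4Printed ζ.C₁ ζ.B₃ ζ.famLG) (p5 : B11.Prop5Printed ζ.B₁ ζ.B₃ ζ.C₁ ζ.famLG) (p6 : B11.Prop6Printed ζ.B₀ ζ.B₃ ζ.C₁ ζ.famLG)
    (p7 : B11.Prop7Printed ζ.B₃ ζ.C₁ (famXOfRecord F N ζ.pinCrit)) (p9 : B11.Prop9Printed ζ.B₅ ζ.C₁ ζ.β₀ ζ.δ₀ ζ.famAn) :
    ∃ w : WorldP, IsRecordOfRecord₁₂CB10YZW F N (datumOfRecord₁₂ F N θ h) w ∧ ∀ P : B12.RunParams, Dag.B11_main (leavesP w P) :=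
  exists_record₁₂CB10YZW_b11_main_of_leaf θ h hθ hγ Mstar ops ζ.pinCrit lamW
    (b11Leaf_Z11OfRecord_pinCrit_of_prop7_chain ζ Dc hgL hX hY dev1142 inU_local holder136 hd hL hB₀ hB₂ hC hR ha₃ ha₄ hB₁ hB₃ hC₁ hc₁
      p2 p3 p4 p5 p6 p7 p9)

end Chain

/-! ## §D N07 at the [B8]-keyed five-pin Stage-12 record and the composable faces at the five- and six-pin views -/

/-- **COMPOSABLE FACE, FIVE-PIN VIEW WITH [B8]**: for ANY world bound to the S-binding at `θ.view₁₂B8B10YZW lam Mstar ops ζ lamW`, the [B11] leaf at `Z11OfRecord F N ζ` gives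
`Dag.B11_main` at every run (the `b11` face of g32's `upOfRecord₅CS_view₁₂B8B10YZW_leaves`; in-edges unused). [cite: Balaban1985Variational, Thm 1 p.279, Props 2–9 pp.281–309 (bookkeeping: the node at the five-pin view)] -/
theorem b11_main_at_view₁₂B8B10YZW_of_leaf (θ : Stage12Params F N) (lam : ResidB8 θ.toStage3Params) (Mstar : ℕ) (ops : OpsY N θ.toStage3Params Mstar)
    (ζ : ResidZ F N) (lamW : ResidW F N) (hup : ∀ P, w.up P = upOfRecord₅CS F N (θ.view₁₂B8B10YZW F N lam Mstar ops ζ lamW) P)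
    (hleaf : B11Leaf (Z11OfRecord F N ζ)) (P : B12.RunParams) : Dag.B11_main (leavesP w P) := by
  intro _ _ _ _ _
  show (w.up P).b11
  rw [hup P]
  exact (upOfRecord₅CS_view₁₂B8B10YZW_leaves F N θ lam Mstar ops ζ lamW P).2.2.2.2.2 hleaf

/-- **COMPOSABLE FACE, SIX-PIN VIEW WITH [B12] AND [B8]**. [cite: Balaban1985Variational, Thm 1 p.279, Props 2–9 pp.281–309 (bookkeeping: the node at the six-pin view)] -/
theorem b11_main_at_view₁₂B12B8B10YZW_of_leaf (θ : Stage12Params F N) (lam12 : ResidB12 F N θ.τ9.M) (lam : ResidB8 θ.toStage3Params) (Mstar : ℕ)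
    (ops : OpsY N θ.toStage3Params Mstar) (ζ : ResidZ F N) (lamW : ResidW F N)
    (hup : ∀ P, w.up P = upOfRecord₅CS F N (θ.view₁₂B12B8B10YZW F N lam12 lam Mstar ops ζ lamW) P)
    (hleaf : B11Leaf (Z11OfRecord F N ζ)) (P : B12.RunParams) : Dag.B11_main (leavesP w P) := by
  intro _ _ _ _ _
  show (w.up P).b11
  rw [hup P]
  exact (upOfRecord₅CS_view₁₂B12B8B10YZW_leaves F N θ lam12 lam Mstar ops ζ lamW P).2.2.2.2.2.2 hleaf

/-- **COMPOSABLE FACE, FIVE-PIN VIEW WITH [B8′]** (the truncated-tower [B8] carrier). [cite: Balaban1985Variational, Thm 1 p.279, Props 2–9 pp.281–309 (bookkeeping: the node at the five-pin view)] -/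
theorem b11_main_at_view₁₂B8subB10YZW_of_leaf (θ : Stage12Params F N) (lam : ResidB8 θ.toStage3Params) (Mstar : ℕ) (ops : OpsY N θ.toStage3Params Mstar)
    (ζ : ResidZ F N) (lamW : ResidW F N) (hup : ∀ P, w.up P = upOfRecord₅CS F N (θ.view₁₂B8subB10YZW F N lam Mstar ops ζ lamW) P)
    (hleaf : B11Leaf (Z11OfRecord F N ζ)) (P : B12.RunParams) : Dag.B11_main (leavesP w P) := by
  intro _ _ _ _ _
  show (w.up P).b11
  rw [hup P]
  exact (upOfRecord₅CS_view₁₂B8subB10YZW_leaves F N θ lam Mstar ops ζ lamW P).2.2.2.2.2 hleaf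

/-- **COMPOSABLE FACE, SIX-PIN VIEW WITH [B12] AND [B8′]** (the richest Stage-12 view of record). [cite: Balaban1985Variational, Thm 1 p.279, Props 2–9 pp.281–309 (bookkeeping: the node at the six-pin view)] -/
theorem b11_main_at_view₁₂B12B8subB10YZW_of_leaf (θ : Stage12Params F N) (lam12 : ResidB12 F N θ.τ9.M) (lam : ResidB8 θ.toStage3Params) (Mstar : ℕ)
    (ops : OpsY N θ.toStage3Params Mstar) (ζ : ResidZ F N) (lamW : ResidW F N)
    (hup : ∀ P, w.up P = upOfRecord₅CS F N (θ.view₁₂B12B8subB10YZW F N lam12 lam Mstar ops ζ lamW) P)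
    (hleaf : B11Leaf (Z11OfRecord F N ζ)) (P : B12.RunParams) : Dag.B11_main (leavesP w P) := by
  intro _ _ _ _ _
  show (w.up P).b11
  rw [hup P]
  exact (upOfRecord₅CS_view₁₂B12B8subB10YZW_leaves F N θ lam12 lam Mstar ops ζ lamW P).2.2.2.2.2.2 hleaf

/-- **N07 «SLOT» FORM at the [B8]-keyed five-pin Stage-12 record** (g33's `b8_main_of_isRecordOfRecord₁₂CB10YZWB8_of_slots` idiom, N07 alone): if the [B11] leaf holds at the bundle of
record of EVERY five-pin package presenting `(D, w)`, then `Dag.B11_main` at every run. [cite: Balaban1985Variational, Thm 1 p.279, Props 2–9 pp.281–309 (the node's shape, bookkeeping)] -/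
theorem b11_main_of_isRecordOfRecord₁₂CB10YZWB8_of_slot (h : IsRecordOfRecord₁₂CB10YZWB8 F N D w)
    (hZ : ∀ (θ : Stage12Params F N) (hP : θ.Provisos₁₂ F N) (lam : ResidB8 θ.toStage3Params) (Mstar : ℕ) (ops : OpsY N θ.toStage3Params Mstar) (ζ : ResidZ F N)
      (lamW : ResidW F N), θ.Admissible F N → D = datumOfRecord₁₂ F N θ hP →
        (∀ P, w.up P = upOfRecord₅CS F N (θ.view₁₂B8B10YZW F N lam Mstar ops ζ lamW) P) → B11Leaf (Z11OfRecord F N ζ))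
    (P : B12.RunParams) : Dag.B11_main (leavesP w P) := by
  obtain ⟨θ, hP, lam, Mstar, ops, ζ, lamW, hθ, hD, -, -, -, hup⟩ := h
  exact b11_main_at_view₁₂B8B10YZW_of_leaf θ lam Mstar ops ζ lamW hup (hZ θ hP lam Mstar ops ζ lamW hθ hD hup) P

/-- **THE ∃-DIRECTION AT THE [B8]-KEYED FIVE-PIN RECORD**: every admissible Stage-12 `θ` with provisos and `γ > 0`, every [B8] layer, floor, operator layer, [IV] layer and a [B11] layer
CARRYING THE LEAF present a ₁₂CB10YZWB8 record over `datumOfRecord₁₂ θ h` at every run of which N07 HOLDS (world bound to the S-binding at the five-pin view; g33's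
`exists_world_isRecordOfRecord₁₂CB10YZWB8` construction).  REAL runs modulo K0′; NOT a discharge. [cite: Balaban1985Variational, Thm 1 p.279, Props 2–9 pp.281–309 (bookkeeping: the node at the five-pin record)] -/
theorem exists_record₁₂CB10YZWB8_b11_main_of_leaf (θ : Stage12Params F N) (h : θ.Provisos₁₂ F N) (hθ : θ.Admissible F N) (hγ : 0 < θ.γ)
    (lam : ResidB8 θ.toStage3Params) (Mstar : ℕ) (ops : OpsY N θ.toStage3Params Mstar) (ζ : ResidZ F N) (lamW : ResidW F N)
    (hleaf : B11Leaf (Z11OfRecord F N ζ)) :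
    ∃ w : WorldP, IsRecordOfRecord₁₂CB10YZWB8 F N (datumOfRecord₁₂ F N θ h) w ∧ ∀ P : B12.RunParams, Dag.B11_main (leavesP w P) := by
  obtain ⟨w₀, -, -⟩ := exists_world_isRecordOfRecord₁₂C F N θ h hθ (γw := θ.γ) ⟨hγ, le_rfl⟩
  refine ⟨{ w₀ with
      C := (datumOfRecord₁₂ F N θ h).C, γ := θ.γ, L := (θ.L : ℝ), one_lt_L := by exact_mod_cast θ.hL.2,
      up := fun P => upOfRecord₅CS F N (θ.view₁₂B8B10YZW F N lam Mstar ops ζ lamW) P },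
    ⟨θ, h, lam, Mstar, ops, ζ, lamW, hθ, rfl, rfl, ⟨hγ, le_rfl⟩, rfl, fun _ => rfl⟩, fun P => ?_⟩
  exact b11_main_at_view₁₂B8B10YZW_of_leaf θ lam Mstar ops ζ lamW (fun _ => rfl) hleaf P

/-- **K1′'s ∃-FORM SERVED AT THE [B8]-KEYED FIVE-PIN RECORD (N07's conjunct)**: GIVEN ₁₂C-inhabitation at the family `F` (the route's K0′ at `F`, HYPOTHESIS) and the [B11] leaf at SOME
residual layer `ζ`, SOME ₁₂C record `(D, w′)` — the given datum, its world RE-BOUND by the S-binding at the five-pin view (g33's `isRecordOfRecord₁₂CB10YZWB8_rebind_of_isRecordOfRecord₁₂C`;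
any [B8] layer `nonempty_residB8`, floor `0`, n22-b's junk operator layer, any [IV] layer) — is a ₁₂CB10YZWB8 record AND carries `Dag.B11_main` at every run; it is also a ₁₂C record
(same datum, same world: `companion_of_…` then `isRecordOfRecord₁₂C_of_…` give the SAME-datum ₁₂C companion — stated here through the four-pin companion world).  N07 ALONE.
[cite: Balaban1985Variational, Thm 1 p.279, Props 2–9 pp.281–309; Balaban1989LargeFieldII, Thm 1 + (0.1) pp.355–356 (bookkeeping)] -/
theorem exists_isRecordOfRecord₁₂C_b11_main_of_leaf_pinB8 (F : T4Family) (hK0 : ∃ (D : Datum F N) (w : WorldP), IsRecordOfRecord₁₂C F N D w)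
    (ζ : ResidZ F N) (hleaf : B11Leaf (Z11OfRecord F N ζ)) :
    ∃ (D : Datum F N) (w : WorldP), IsRecordOfRecord₁₂CB10YZWB8 F N D w ∧ ∀ P : B12.RunParams, Dag.B11_main (leavesP w P) := by
  obtain ⟨D, w, h⟩ := hK0
  obtain ⟨θ, _, hθ, -, h12⟩ := isRecordOfRecord₁₂CB10YZWB8_rebind_of_isRecordOfRecord₁₂C h
  obtain ⟨lam⟩ := nonempty_residB8 (θ := θ.toStage3Params)
  obtain ⟨ops, -, -⟩ := exists_junkOps_b9LeafX_Y9OfRecord (N := N) θ.toStage3Params hθ.1.1.1.1.1 0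
  obtain ⟨lamW⟩ := nonempty_residW F N
  exact ⟨D, _, h12 lam 0 ops ζ lamW, b11_main_at_view₁₂B8B10YZW_of_leaf θ lam 0 ops ζ lamW (fun _ => rfl) hleaf⟩

/-! ## §E The node sentence in print's (9)–(10) currency under the soundness law of the residual regularity data (node00-def-B11 g3's ask) -/

section Reg910

variable {L : ℝ} {η : ZIdx → ℝ} [Fact (0 < L)] [∀ i, Fact (0 < η i)] {β : ZIdx → Type} [∀ i, Fintype (β i)]

/-- ★ **N07's NODE SENTENCE IN PRINT's REGULARITY CURRENCY**: §B's displayed inputs at the doubly-pinned layer `(ζ.withSectE E).pinCrit` (Props 2, 3, 5, 8, Sect. F, Prop. 9, the bridge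
data with (14) and its two printed clauses, the capped existence leaves, the constant relations) + node00-def-B11 g3's SOUNDNESS LAW `hs : ζ.RegSound g` («when `ζ.R i` says gauged at
(U, □), its five numbers read an actual gauge u, A with Uᵘ = e^{iηA} on □») ⇒ THEOREM 1's (9)–(10) IN PRINT's ∃u-FORM `B11Reg910Classes.Reg910T`: one block of constants `C`; for every
member `i`, every `0 < ε₁ ≤ a₁`, every `V` with (7), every minimiser `U` of (5) on 𝔘_k(C.B₃ε₁) ∩ 𝔅_k(V), every cube `□` of the residual geometry with `M(□) ≤ M(ε₁)`: (9)–(10) with radii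
`C.B₃M(□)ε₁`, `C.B₄M(□)ε₁` (`reg910T_of_b11Leaf_withSectE_pinCrit_of_regSound` ∘ §B, BY NAME).  F8 stays HALVED: the law is DISPLAYED (the gauge-fixed pin of `ζ.R` via
[Balaban1985RegularSpaces] Thm 2 as a map on NODE 00's gauge fields is unowned); NOT a discharge. [cite: Balaban1985Variational, Thm 1 (9)–(10) pp.278–279, Props 2–9 pp.281–309] -/
theorem reg910T_withSectE_pinCrit_of_towerT_parts_kappa_one_of_regSound (ζ : ResidZ F N) {g : ∀ i : ZIdx, RegGeomT F N i.K (ζ.R i)}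
    (hs : ζ.RegSound g) (E : SectEPres F N L η β ζ) (hC₄ : 0 < E.C₄) (ha₃ : 0 < E.a₃) (hα : 0 < E.α)
    (βr : ∀ i : ZIdx, Bridge (famXOfRecord F N (ζ.withSectE E).pinCrit i) ((ζ.withSectE E).famLG i))
    (bg : ∀ i : ZIdx, GaugeField (F.P i.K) 0 (SU N) → ((ζ.withSectE E).famLG i).Cfg) {O₁ O₂ e₅ : ℝ}
    (hbg14 : ∀ (i : ZIdx) (ε : ℝ) (V : GaugeField (F.P i.K) i.k (SU N)) (U : GaugeField (F.P i.K) 0 (SU N)),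
      InUkClassB11 F N i.K i.k (ζ.C₁ * ζ.B₃ * ε) U → Averaging.iter (avOfRecord F N i.K) i.k U = V →
        ((ζ.withSectE E).famLG i).Sat14 (ζ.C₁ * ζ.B₃ * ε) (ζ.C₁ * ε) ((βr i).bdry V) (bg i U))
    (gaugeFix : ∀ (i : ZIdx) (ε₀ ε₁ : ℝ) (V : GaugeField (F.P i.K) i.k (SU N)) (U₀ : ((ζ.withSectE E).famLG i).Cfg) (U : GaugeField (F.P i.K) 0 (SU N)),
      ((ζ.withSectE E).famLG i).Sat14 (ζ.C₁ * ζ.B₃ * ε₁) (ζ.C₁ * ε₁) ((βr i).bdry V) U₀ → InUkClassB11 F N i.K i.k ε₀ U →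
        Averaging.iter (avOfRecord F N i.K) i.k U = V →
          ∃ U' : ((ζ.withSectE E).famLG i).Pert, ((ζ.withSectE E).famLG i).In18 ε₀ ((βr i).bdry V) U₀ U' ∧ OrbitRel i.k U ((βr i).emb U₀ U') ∧
            (IsCritOfRecord F N i.K i.k V U → ((ζ.withSectE E).famLG i).Crit ((βr i).bdry V) U₀ U'))
    (orbit16 : ∀ (i : ZIdx) (U₀ : ((ζ.withSectE E).famLG i).Cfg) (U₁ : ((ζ.withSectE E).famLG i).Pert) (u u' : ((ζ.withSectE E).famLG i).GT),
      ((ζ.withSectE E).famLG i).Restricted U₀ u → ((ζ.withSectE E).famLG i).Restricted U₀ u' →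
        OrbitRel i.k ((βr i).emb U₀ (((ζ.withSectE E).famLG i).toAxial U₀ U₁ u)) ((βr i).emb U₀ (((ζ.withSectE E).famLG i).toAxial U₀ U₁ u')))
    (leaves : ∀ i, ExistenceLeavesCap (βr i) ζ.B₀ ζ.B₃ ζ.C₁ O₁ O₂ e₅)
    (hB₀ : 0 < ζ.B₀) (hB₁ : 0 < ζ.B₁) (hB₃ : 1 ≤ ζ.B₃) (hC₁L : (F.L : ℝ) ^ 3 ≤ ζ.C₁) (hB₀B₁ : ζ.B₀ ≤ 4 * ζ.B₁)
    (hc₁ : 0 < ζ.c₁) (hO₁ : 0 < O₁) (hO₂ : 0 < O₂) (he₅ : 0 < e₅)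
    (p2 : B11.Prop2Printed ζ.B₁ ζ.B₃ ζ.C₁ ζ.c₁ (ζ.withSectE E).famLG) (p3 : B11.Prop3Printed ζ.C₁ ζ.B₃ ζ.C₂ ζ.C₃ ζ.B₀ ζ.c1h ζ.c₄ ζ.δ₀ (ζ.withSectE E).famLG)
    (p5 : B11.Prop5Printed ζ.B₁ ζ.B₃ ζ.C₁ (ζ.withSectE E).famLG)
    (p8 : B11.Prop8Printed ζ.B₃ (famXOfRecord F N (ζ.withSectE E).pinCrit)) (sF : B11.SectFPrinted ζ.B₃ (famXOfRecord F N (ζ.withSectE E).pinCrit))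
    (p9 : B11.Prop9Printed ζ.B₅ ζ.C₁ ζ.β₀ ζ.δ₀ ζ.famAn) :
    ∃ C : B11Thm1.Consts, ∀ (i : ZIdx) (ε₁ : ℝ), 0 < ε₁ → ε₁ ≤ C.a₁ → ∀ V : GaugeField (F.P i.K) i.k (SU N), PlaqSmall ε₁ V →
      ∀ U : GaugeField (F.P i.K) 0 (SU N), IsBackground (avOfRecord F N i.K) {U | InUkClassB11 F N i.K i.k (C.B₃ * ε₁) U} i.k V U →
        ∀ c : (ζ.R i).Cube, (ζ.R i).sizeM c ≤ C.Mfun ε₁ →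
          Reg910T F N i.K i.k U ((g i).carrier c) ((ζ.R i).scale c) (g i).dist (C.B₃ * (ζ.R i).sizeM c * ε₁) (C.B₄ * (ζ.R i).sizeM c * ε₁) 1 :=
  reg910T_of_b11Leaf_withSectE_pinCrit_of_regSound hs E
    (b11Leaf_Z11OfRecord_withSectE_pinCrit_of_towerT_parts_kappa_one_of_gaugeFix_orbit16 ζ E hC₄ ha₃ hα βr bg hbg14 gaugeFix orbit16 leaves
      hB₀ hB₁ hB₃ hC₁L hB₀B₁ hc₁ hO₁ hO₂ he₅ p2 p3 p5 p8 sF p9)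

end Reg910

end Summit.QuantumFields.YangMills.BalabanUVNodes.N07AtRecord12Sides

end
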